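import Literature.Geometry.Lorentzian.SchwarzschildKerrSchildComponents
import Literature.Geometry.Lorentzian.KerrDataSchwarzschildExtrinsic
import Literature.Geometry.Lorentzian.KerrConvergenceProofs
import HarnessLib

/-!
# Route PhotonSphereChannels · crux `ChannelsResolveTameDevelopmentsR` (K2R-T2, stmt-FinalStateConjecture-17430) —
# the SCHWARZSCHILD END, IV-b: static spherically symmetric bilinear fields
# `η + a(r) dt*² + b(r)(dt* ⊗ σ + σ ⊗ dt*) + c(r) σ ⊗ σ`, `σ = ⟪x⃗, ·⃗⟫`, on `E4` — smoothness, time invariance,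
# global `Cᵐ` bounds, and the two instances: the Kerr–Schild form of `g_{M,0}` and its pull-back to a radial clock

The clock-adapted tame balls of the Schwarzschild end (file IV-d) read the metric in "clock coordinates"
`(τ = t* + F(r), x⃗)`: pointwise, `g̃_x(u, w) = g_{M,0}(P_x u, P_x w)` with `P_x u = u − F'(r) ν(u) ∂_{t*}`,
`ν(u) = ⟪x⃗, u⃗⟫/r`. Both `g_{M,0}` and `g̃` are RADIAL FORMS: `η + a(r) dt*² + b(r)(dt* ⊗ σ + σ ⊗ dt*) + c(r) σ ⊗ σ`
with `σ_x = ⟪x⃗, ·⃗⟫` (`Kerr.covecSpatial (E4.spatial x)`), for three radial profiles `a, b, c : ℝ → ℝ`: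

* `Schw.radialForm_apply`, `Schw.radialForm_static` — components and `t*`-invariance of a radial form `G`
  (hypothesis-described: `hG : ∀ x, G x = η + a(r(x)) • dt*⊗dt* + …`);
* `Schw.contDiff_radialForm` — `G` is `C^∞` on ALL of `E4` as soon as the three coefficient fields `x ↦ a(‖x⃗‖)`, …
  are (`Schw.contDiff_comp_spatialNorm`: true for a smooth profile vanishing near `r = 0`, the cutoff at the time axis);
* `Schw.norm_iteratedFDeriv_le_of_radial` — **global `Cᵐ` bounds**: a `C^∞`, `t*`-invariant field which coincides with
  `g_{M,0}` beyond some radius has `‖Dᵐ G‖ ≤ C_m` on all of `E4` (compactness on a slab of the slice `{t* = 0}` +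
  the far decay `‖Dᵐ(g_{M,0} − η)‖ ≤ C/r`, `Kerr.norm_iteratedFDeriv_ksPert_le`);
* `Schw.bilin_zero_eq_radialForm` — `g_{M,0} = η + (2M/r) dt*² + (2M/r²)(dt*⊗σ + σ⊗dt*) + (2M/r³) σ⊗σ` off the axis;
* `Schw.bilin_clockPullback_eq_radialForm` — **the metric in radial-clock coordinates**: for `P u = u − p ν(u) ∂_{t*}`,
  `g_{M,0}(P u, P w) = η(u,w) + s² u⁰w⁰ + (μ/r)(u⁰σ(w) + σ(u)w⁰) + (κ/r²) σ(u)σ(w)`, `s² = 2M/r`,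
  `μ = s² + p(1 − s²)`, `κ = s²(1 − p)² − p²` (at the Painlevé–Gullstrand rate `p = s/(1+s)`: `κ = 0`, `μ = s` — flat
  slices, unit lapse).

Everything is proved; no definitions. References: K. Martel, E. Poisson, Am. J. Phys. 69 (2001) 476, §II
[MartelPoisson2001]; M. Visser, arXiv:0706.0622, (32)–(35) [arXiv07060622]; R. P. Kerr, A. Schild (1965), §3
[KerrSchild1965].
-/

noncomputable section
set_option maxSynthPendingDepth 3 -- nested operator types `E4 →L E4 →L E4 →L ℝ` (as in the tree files)
set_option linter.dupNamespace false -- `Summit.FinalStateConjecture.FinalStateConjecture.…` is the tree's layout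

open TopologicalSpace Filter Topology Set Function Metric
open scoped ContDiff Topology InnerProductSpace

namespace Summit.FinalStateConjecture.FinalStateConjecture.Theorems.TameHull.Schw

open Literature.Geometry.Lorentzian Schwarzschild

/-! ### Smooth radial coefficient fields -/

/-- **A smooth radial profile vanishing near `0` gives a smooth field on `E4`**: if `φ : ℝ → ℝ` is `C^∞` and `φ = 0`
on `(-∞, ε]`, `ε > 0`, then `x ↦ φ(‖x⃗‖)` is `C^∞` on all of `E4` (off the time axis `‖x⃗‖` is smooth; near it the
field vanishes identically). [folklore] -/
theorem contDiff_comp_spatialNorm {φ : ℝ → ℝ} (hφ : ContDiff ℝ ∞ φ) {ε : ℝ} (hε : 0 < ε) (hφ0 : ∀ r, r ≤ ε → φ r = 0) :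
    ContDiff ℝ ∞ fun x : E4 ↦ φ (E4.spatialNorm x) := by
  rw [contDiff_iff_contDiffAt]
  intro x
  by_cases hx : E4.spatialNorm x < ε
  · -- locally zero
    have hev : (fun x : E4 ↦ φ (E4.spatialNorm x)) =ᶠ[𝓝 x] fun _ ↦ 0 := by
      have ho : IsOpen {y : E4 | E4.spatialNorm y < ε} :=
        isOpen_lt (continuous_norm.comp E4.spatial.continuous) continuous_const
      filter_upwards [ho.mem_nhds hx] with y hy
      exact hφ0 _ (le_of_lt hy)
    exact contDiffAt_const.congr_of_eventuallyEq hev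
  · have hx0 : E4.spatial x ≠ 0 := by
      intro h
      apply hx
      rw [E4.spatialNorm, h, norm_zero]
      exact hε
    exact hφ.contDiffAt.comp x ((contDiffAt_norm ℝ hx0).comp x E4.spatial.contDiff.contDiffAt)

/-- A cutoff times a profile smooth on `[ε, ∞)`: if `χ₀` is `C^∞` with `χ₀ = 0` on `(-∞, ε]`, `0 < ε`, and `φ` is
`C^∞` at every `r ≥ ε`, then `χ₀ · φ` is `C^∞` on `ℝ` and vanishes on `(-∞, ε]`. [folklore] -/
theorem contDiff_cutoff_mul {χ₀ φ : ℝ → ℝ} (hχ₀ : ContDiff ℝ ∞ χ₀) {ε : ℝ} (hχ₀0 : ∀ r, r ≤ ε → χ₀ r = 0)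
    (hφ : ∀ r, ε ≤ r → ContDiffAt ℝ ∞ φ r) :
    ContDiff ℝ ∞ (fun r ↦ χ₀ r * φ r) ∧ ∀ r, r ≤ ε → χ₀ r * φ r = 0 := by
  refine ⟨?_, fun r hr ↦ by rw [hχ₀0 r hr, zero_mul]⟩
  rw [contDiff_iff_contDiffAt]
  intro r
  by_cases hr : r < ε
  · have hev : (fun r ↦ χ₀ r * φ r) =ᶠ[𝓝 r] fun _ ↦ 0 := by
      filter_upwards [Iio_mem_nhds hr] with t ht
      rw [hχ₀0 t (le_of_lt ht), zero_mul]
    exact contDiffAt_const.congr_of_eventuallyEq hev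
  · exact hχ₀.contDiffAt.mul (hφ r (not_lt.mp hr))

/-! ### Radial forms -/

section RadialForm

variable {a b c : ℝ → ℝ} {G : E4 → E4 →L[ℝ] E4 →L[ℝ] ℝ}
  (hG : ∀ x, G x = Minkowski.bilin + a (E4.spatialNorm x) • E4.tmul (E4.dx 0) (E4.dx 0) +
    b (E4.spatialNorm x) • (E4.tmul (E4.dx 0) (Kerr.covecSpatial (E4.spatial x)) +
      E4.tmul (Kerr.covecSpatial (E4.spatial x)) (E4.dx 0)) +
    c (E4.spatialNorm x) • E4.tmul (Kerr.covecSpatial (E4.spatial x)) (Kerr.covecSpatial (E4.spatial x)))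
include hG

/-- **Components of a radial form**: `G_x(u, w) = η(u, w) + a(r) u⁰w⁰ + b(r)(u⁰⟪x⃗,w⃗⟫ + ⟪x⃗,u⃗⟫w⁰) + c(r)⟪x⃗,u⃗⟫⟪x⃗,w⃗⟫`.
[folklore] -/
theorem radialForm_apply (x u w : E4) :
    G x u w = Minkowski.bilin u w + a (E4.spatialNorm x) * (u 0 * w 0) +
      b (E4.spatialNorm x) * (u 0 * sdot x w + sdot x u * w 0) + c (E4.spatialNorm x) * (sdot x u * sdot x w) := by
  rw [hG x]
  simp only [_root_.add_apply, FunLike.coe_smul, Pi.smul_apply, E4.tmul_apply, Kerr.covecSpatial_apply,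
    smul_eq_mul, sdot]
  simp [E4.dx]

/-- **Radial forms are static**: the spatial part, hence `G`, is unchanged under `x ↦ x + s ∂_{t*}`. [folklore] -/
theorem radialForm_static (x : E4) (s : ℝ) :
    E4.spatial (x + s • E4.basisVector 0) = E4.spatial x ∧ G (x + s • E4.basisVector 0) = G x := by
  have hs : E4.spatial (x + s • E4.basisVector 0) = E4.spatial x := by
    rw [map_add, map_smul]
    have : E4.spatial (E4.basisVector 0) = 0 := by ext i; simp
    rw [this, smul_zero, add_zero]
  refine ⟨hs, ?_⟩
  rw [hG, hG x, E4.spatialNorm, E4.spatialNorm, hs]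

omit hG in
/-- The covector field `x ↦ σ_x = ⟪x⃗, ·⃗⟫` is a continuous linear function of `x`, hence `C^∞`. [folklore] -/
theorem contDiff_covecSpatial_spatial : ContDiff ℝ ∞ fun x : E4 ↦ Kerr.covecSpatial (E4.spatial x) :=
  (Kerr.covecSpatial.comp E4.spatial).contDiff

omit hG in
/-- `(α, β) ↦ α ⊗ β` (`E4.tmul = smulRight`) is `C^∞` along smooth covector fields. [folklore] -/
theorem contDiff_tmul {α β : E4 → E4 →L[ℝ] ℝ} (hα : ContDiff ℝ ∞ α) (hβ : ContDiff ℝ ∞ β) :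
    ContDiff ℝ ∞ fun x ↦ E4.tmul (α x) (β x) :=
  (isBoundedBilinearMap_smulRight (𝕜 := ℝ) (E := E4) (F := E4 →L[ℝ] ℝ)).contDiff.comp (hα.prodMk hβ)

/-- **Smoothness of radial forms**: if the three coefficient fields `x ↦ a(‖x⃗‖)`, `x ↦ b(‖x⃗‖)`, `x ↦ c(‖x⃗‖)` are
`C^∞` on `E4` (e.g. by `contDiff_comp_spatialNorm`), so is `G`. [folklore] -/
theorem contDiff_radialForm (ha : ContDiff ℝ ∞ fun x : E4 ↦ a (E4.spatialNorm x))
    (hb : ContDiff ℝ ∞ fun x : E4 ↦ b (E4.spatialNorm x)) (hc : ContDiff ℝ ∞ fun x : E4 ↦ c (E4.spatialNorm x)) :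
    ContDiff ℝ ∞ G := by
  have hGf : G = fun x ↦ Minkowski.bilin + a (E4.spatialNorm x) • E4.tmul (E4.dx 0) (E4.dx 0) +
      b (E4.spatialNorm x) • (E4.tmul (E4.dx 0) (Kerr.covecSpatial (E4.spatial x)) +
        E4.tmul (Kerr.covecSpatial (E4.spatial x)) (E4.dx 0)) +
      c (E4.spatialNorm x) • E4.tmul (Kerr.covecSpatial (E4.spatial x)) (Kerr.covecSpatial (E4.spatial x)) :=
    funext hG
  rw [hGf]
  have hσ := contDiff_covecSpatial_spatial
  have hdx : ContDiff ℝ ∞ fun _ : E4 ↦ (E4.dx 0 : E4 →L[ℝ] ℝ) := contDiff_const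
  exact ((contDiff_const.add (ha.smul (contDiff_tmul hdx hdx))).add
    (hb.smul ((contDiff_tmul hdx hσ).add (contDiff_tmul hσ hdx)))).add (hc.smul (contDiff_tmul hσ hσ))

end RadialForm

/-! ### Global `Cᵐ` bounds for static fields which are Kerr–Schild beyond some radius -/

/-- Translating the argument along `∂_{t*}` does not change the derivatives of a static field. [folklore] -/
theorem iteratedFDeriv_add_time_smul {G : E4 → E4 →L[ℝ] E4 →L[ℝ] ℝ} (hstat : ∀ (x : E4) (s : ℝ), G (x + s • E4.basisVector 0) = G x)
    (m : ℕ) (x : E4) (s : ℝ) : iteratedFDeriv ℝ m G (x + s • E4.basisVector 0) = iteratedFDeriv ℝ m G x := by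
  have hfun : (fun y ↦ G (y + s • E4.basisVector 0)) = G := funext fun y ↦ hstat y s
  rw [← iteratedFDeriv_comp_add_right, hfun]

/-- **Global `Cᵐ` bounds.** Let `G : E4 → (bilinear forms)` be `C^∞`, static (`G(x + s∂_{t*}) = G x`) and equal to the
Schwarzschild Kerr–Schild components `g_{M,0}` at every point with `‖x⃗‖ > R₀`. Then every derivative of `G` is bounded
on ALL of `E4`: on the slice `{t* = 0}` the closed ball `‖x⃗‖ ≤ R₁` is compact and `Dᵐ G` is continuous, beyond `R₁`
(chosen past `R₀`, past `1` and past the radius of the far decay estimate `‖Dᵐ(g_{M,0} − η)‖ ≤ C/r`,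
`Kerr.norm_iteratedFDeriv_ksPert_le`) the field is `η + (g_{M,0} − η)` with bounded derivatives, and staticity moves
every point to the slice. [cite: KerrSchild1965, §3] -/
theorem norm_iteratedFDeriv_le_of_radial {G : E4 → E4 →L[ℝ] E4 →L[ℝ] ℝ} (hGs : ContDiff ℝ ∞ G)
    (hstat : ∀ (x : E4) (s : ℝ), G (x + s • E4.basisVector 0) = G x) {M R₀ : ℝ}
    (hfar : ∀ x, R₀ < E4.spatialNorm x → G x = Kerr.bilin M 0 x) (m : ℕ) :
    ∃ C : ℝ, ∀ x, ‖iteratedFDeriv ℝ m G x‖ ≤ C := by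
  -- far decay of the Kerr–Schild perturbation
  obtain ⟨Cf, Rf, hRf, hCf⟩ := Kerr.norm_iteratedFDeriv_ksPert_le M 0 m
  set R₁ : ℝ := max (max R₀ 0 + 1) (Rf + 1) with hR₁
  -- the compact part: the slice `{t* = 0}`, `‖y‖ ≤ R₁`
  have hcont : Continuous fun y : E3 ↦ ‖iteratedFDeriv ℝ m G (E4.ofTimeSpace 0 y)‖ :=
    continuous_norm.comp ((hGs.continuous_iteratedFDeriv (by exact_mod_cast le_top)).comp (E4.continuous_ofTimeSpace 0))
  obtain ⟨C₁, hC₁⟩ := (isCompact_closedBall (0 : E3) R₁).exists_bound_of_continuousOn hcont.continuousOn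
  refine ⟨max |C₁| (|Cf| + ‖(Minkowski.bilin : E4 →L[ℝ] E4 →L[ℝ] ℝ)‖), fun x ↦ ?_⟩
  -- move `x` to the slice `{t* = 0}`
  have hx : E4.ofTimeSpace 0 (E4.spatial x) + (x 0) • E4.basisVector 0 = x := by
    ext i
    refine Fin.cases ?_ (fun j ↦ ?_) i
    · simp [E4.ofTimeSpace_apply_zero]
    · simp [E4.ofTimeSpace_apply_succ, E4.spatial_apply, Fin.succ_ne_zero]
  have hslice : iteratedFDeriv ℝ m G x = iteratedFDeriv ℝ m G (E4.ofTimeSpace 0 (E4.spatial x)) := by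
    conv_lhs => rw [← hx]
    exact iteratedFDeriv_add_time_smul hstat m _ _
  rw [hslice]
  by_cases hR : ‖E4.spatial x‖ ≤ R₁
  · have h := hC₁ (E4.spatial x) (mem_closedBall_zero_iff.mpr hR)
    rw [Real.norm_eq_abs, abs_norm] at h
    exact (h.trans (le_abs_self _)).trans (le_max_left _ _)
  · push Not at hR
    set z : E4 := E4.ofTimeSpace 0 (E4.spatial x) with hz
    have hzn : E4.spatialNorm z = ‖E4.spatial x‖ := by rw [hz, E4.spatialNorm_ofTimeSpace]
    have hR₀z : R₀ < E4.spatialNorm z := by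
      rw [hzn]
      have : max R₀ 0 + 1 ≤ R₁ := le_max_left _ _
      linarith [le_max_left R₀ 0]
    -- `G = g_{M,0}` near `z` (an open condition), so the derivatives agree
    have hev : G =ᶠ[𝓝 z] Kerr.bilin M 0 := by
      have ho : IsOpen {y : E4 | R₀ < E4.spatialNorm y} :=
        isOpen_lt continuous_const (continuous_norm.comp E4.spatial.continuous)
      filter_upwards [ho.mem_nhds hR₀z] with y hy
      exact hfar y hy
    rw [(hev.iteratedFDeriv ℝ m).eq_of_nhds]
    have hrz : Rf ≤ Kerr.radius 0 z ∧ 1 ≤ Kerr.radius 0 z := by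
      rw [Kerr.radius_zero_left, hzn]
      have : Rf + 1 ≤ R₁ := le_max_right _ _
      constructor <;> linarith
    have hr0 : 0 < Kerr.radius 0 z := by linarith [hrz.2]
    -- `Dᵐ g_{M,0} = Dᵐ (g_{M,0} − η) + Dᵐ η`
    have hsplit : iteratedFDeriv ℝ m (Kerr.bilin M 0) z =
        iteratedFDeriv ℝ m (fun y ↦ Kerr.bilin M 0 y - Minkowski.bilin) z +
          iteratedFDeriv ℝ m (fun _ : E4 ↦ (Minkowski.bilin : E4 →L[ℝ] E4 →L[ℝ] ℝ)) z := by
      have hf : Kerr.bilin M 0 = (fun y ↦ Kerr.bilin M 0 y - Minkowski.bilin) + fun _ ↦ Minkowski.bilin := by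
        funext y; simp
      conv_lhs => rw [hf]
      exact iteratedFDeriv_add_apply ((Kerr.contDiffAt_ksPert hr0).of_le le_top) contDiffAt_const
    rw [hsplit]
    refine ((norm_add_le _ _).trans (add_le_add ?_ ?_)).trans (le_max_right _ _)
    · calc ‖iteratedFDeriv ℝ m (fun y ↦ Kerr.bilin M 0 y - Minkowski.bilin) z‖ ≤ Cf / Kerr.radius 0 z := hCf z hrz.1
        _ ≤ |Cf| / Kerr.radius 0 z := div_le_div_of_nonneg_right (le_abs_self _) hr0.le
        _ ≤ |Cf| := div_le_self (abs_nonneg _) hrz.2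
    · rcases Nat.eq_zero_or_pos m with hm | hm
      · subst hm
        rw [norm_iteratedFDeriv_zero]
      · rw [iteratedFDeriv_const_of_ne (Nat.pos_iff_ne_zero.mp hm)]
        simp

/-! ### The two instances: `g_{M,0}` and its pull-back to a radial clock -/

/-- `⟪x⃗, (∂_{t*})⃗⟫ = 0`, `(∂_{t*})⁰ = 1`, `(∂_{t*})⃗ = 0` (components of the stationary field). [folklore] -/
theorem basisVector_zero_components (x : E4) :
    sdot x (E4.basisVector 0) = 0 ∧ (E4.basisVector 0 : E4) 0 = 1 ∧ E4.spatial (E4.basisVector 0) = 0 := by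
  have h : E4.spatial (E4.basisVector 0) = 0 := by ext i; simp
  exact ⟨by rw [sdot, h, inner_zero_right], by simp, h⟩

/-- **The Schwarzschild metric is a radial form**: off the time axis,
`g_{M,0}(u, w) = η(u, w) + (2M/r) u⁰w⁰ + (2M/r²)(u⁰⟪x⃗,w⃗⟫ + ⟪x⃗,u⃗⟫w⁰) + (2M/r³)⟪x⃗,u⃗⟫⟪x⃗,w⃗⟫`
(`ℓ = dt* + σ/r`). Visser arXiv:0706.0622, (32)–(34). [cite: arXiv07060622, (32)–(34)] -/
theorem bilin_zero_apply_radial (M : ℝ) {x : E4} (hx : E4.spatialNorm x ≠ 0) (u w : E4) :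
    Kerr.bilin M 0 x u w = Minkowski.bilin u w + 2 * M / E4.spatialNorm x * (u 0 * w 0) +
      2 * M / E4.spatialNorm x ^ 2 * (u 0 * sdot x w + sdot x u * w 0) +
        2 * M / E4.spatialNorm x ^ 3 * (sdot x u * sdot x w) := by
  rw [Kerr.bilin_zero_spin_apply M hx, Kerr.minkowski_bilin_eq_spatial]
  simp only [sdot]
  field_simp
  ring

/-- **The Schwarzschild metric read in radial-clock coordinates is a radial form.** With `r = ‖x⃗‖ ≠ 0`, `s² = 2M/r`,
a rate `p` and `P u = u − p (⟪x⃗,u⃗⟫/r) ∂_{t*}` (the differential of `(τ, x⃗) ↦ (τ − F(r), x⃗)` at a point with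
`F'(r) = p`): `g_{M,0}(P u, P w) = η(u,w) + s² u⁰w⁰ + (μ/r)(u⁰⟪x⃗,w⃗⟫ + ⟪x⃗,u⃗⟫w⁰) + (κ/r²)⟪x⃗,u⃗⟫⟪x⃗,w⃗⟫` with
`μ = s² + p(1 − s²)`, `κ = s²(1 − p)² − p²`. At the Painlevé–Gullstrand rate `p = s/(1 + s)` one gets `κ = 0`, `μ = s`:
`g = −dτ² + (dx⃗ + √(2M/r) x̂ dτ)²`. Martel–Poisson 2001, §II. [cite: MartelPoisson2001, §II] -/
theorem bilin_clockPullback_apply (M p : ℝ) {x : E4} (hx : E4.spatialNorm x ≠ 0) (u w : E4) :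
    Kerr.bilin M 0 x (u - (p * (sdot x u / E4.spatialNorm x)) • E4.basisVector 0)
        (w - (p * (sdot x w / E4.spatialNorm x)) • E4.basisVector 0) =
      Minkowski.bilin u w + 2 * M / E4.spatialNorm x * (u 0 * w 0) +
        (2 * M / E4.spatialNorm x + p * (1 - 2 * M / E4.spatialNorm x)) / E4.spatialNorm x *
          (u 0 * sdot x w + sdot x u * w 0) +
        (2 * M / E4.spatialNorm x * (1 - p) ^ 2 - p ^ 2) / E4.spatialNorm x ^ 2 * (sdot x u * sdot x w) := by
  obtain ⟨h0, h1, hsp⟩ := basisVector_zero_components x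
  simp only [map_sub, map_smul, FunLike.coe_sub, FunLike.coe_smul, Pi.sub_apply, Pi.smul_apply, smul_eq_mul]
  rw [bilin_zero_apply_radial M hx u w, bilin_zero_apply_radial M hx u (E4.basisVector 0),
    bilin_zero_apply_radial M hx (E4.basisVector 0) w, bilin_zero_apply_radial M hx (E4.basisVector 0) (E4.basisVector 0),
    Kerr.minkowski_bilin_eq_spatial, Kerr.minkowski_bilin_eq_spatial, Kerr.minkowski_bilin_eq_spatial,
    Kerr.minkowski_bilin_eq_spatial, hsp, h0, h1]
  simp only [inner_zero_left, inner_zero_right, mul_zero, zero_mul, add_zero, mul_one, one_mul]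
  field_simp
  ring

/-- Registered summary (stmt-FinalStateConjecture-17430, route seat 1): **the Schwarzschild metric read through a radial
clock `t* + F(r)`, `F' = p`, is the radial form with coefficients `(2M/r, μ/r, κ/r²)`**, `μ = s² + p(1 − s²)`,
`κ = s²(1 − p)² − p²`, `s² = 2M/r`. [cite: MartelPoisson2001, §II] -/
theorem schwarzschild_clockPullback_radialForm : ∀ (M p : ℝ) (x : E4), E4.spatialNorm x ≠ 0 → ∀ u w : E4, Kerr.bilin M 0 x (u - (p * (sdot x u / E4.spatialNorm x)) • E4.basisVector 0) (w - (p * (sdot x w / E4.spatialNorm x)) • E4.basisVector 0) = Minkowski.bilin u w + 2 * M / E4.spatialNorm x * (u 0 * w 0) + (2 * M / E4.spatialNorm x + p * (1 - 2 * M / E4.spatialNorm x)) / E4.spatialNorm x * (u 0 * sdot x w + sdot x u * w 0) + (2 * M / E4.spatialNorm x * (1 - p) ^ 2 - p ^ 2) / E4.spatialNorm x ^ 2 * (sdot x u * sdot x w) :=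
  fun M p _ hx u w ↦ bilin_clockPullback_apply M p hx u w

end Summit.FinalStateConjecture.FinalStateConjecture.Theorems.TameHull.Schw

end
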